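import Summits.QuantumFields.BalabanUV.T4Continuum.Support.NE7TopFrameReadingSpikeLetters
import HarnessLib

/-!
# Support | NE7 (gen 98, ROAD-Γ′ S2′ preparation — THE SPIKE LETTERS WITHOUT A TRIVIAL TOP FRAME): gen 97's corner-sum letters of the residual top frame reading and the two letters of the
# corner spikes `S := gaugeDir W (spikeW M (framePotW L (j+1) W X))`, RE-ISSUED with the hypothesis `log v_{j+1} ≡ 0` REPLACED by the additive FRAME MASSES `Σ_z‖log v_{j+1}(z)‖²` and
# `Σ_z‖log v_{j+1}(z)‖` — `Σ_z‖f_z‖² ≤ 3·Σ_z‖log v_z‖² + 3·(Γ3-ℓ² letter) + 3·(rem-ℓ² letter)`, `Σ_z‖f_z‖ ≤ Σ_z‖log v_z‖ + (Γ3-ℓ¹ letter) + (rem-ℓ¹ letter)`, and the same spike bookkeeping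

Cell `pub-balaban`, rung (B)+1 sub-cell t4, lineage `b2b-balaban-t4-ne7-p1` (CRUX PROVER NE7 #1 = OWNER of row NE7), generation 98; memo `t4/b2b-balaban-t4-ne7-p1-g98/ROAD-G98.md` §2.8.
Over gen 97's kernel theorems BY NAME: the dictionary `NE7AccumulatedFrameDictionary.framePotW_eq_sum_frameLin ∕ level_dictionary`, `NE7AccumulatedFrameDefectLocal.norm_frameLin_le_pathAvg`, the four
corner-sum letters `NE7AccumulatedFrameDefectCornerSums.sum_corners_normSq_defect_le ∕ sum_corners_norm_defect_le`, `NE7AccumulatedFrameDefectRemCornerSums.sum_corners_sq_pathAvg_rem_le`,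
`NE7AccumulatedFrameDefectRemCornerSumsL1.sum_corners_sum_pathAvg_rem_le`, and the spike kinematics `NE7CornerSpikeTopDictionary.dirSq_gaugeDir_spikeW_le ∕ curlSq_gaugeDir_spikeW_le`,
`NE7TopFrameReadingSpikeLetters.sum_norm_curl_gaugeDir_spikeW_le`.

WHY (memo §2.8).  ROAD-Γ′'s repaired top normalisation S2′ rotates the corners by the inverse accumulated frame (`u(L^{j+1}•z) = v_{j+1}(z)`, `hdbar` by row NE3's `dbar_of_frame_eq`), so the final
representative has `log v_{j+1}(z) = log u(L^{j+1}•z) =: θ_z ≠ 0` (second order, k-free masses) instead of gen 97's `log v_{j+1} ≡ 0`; the frame part `framePotW X = log v − (second-order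
defect)` carried by the corner spikes then has corner masses `≤` the FRAME MASSES plus gen 97's defect letters.  THIS FILE is that bookkeeping: `NE7TopFrameReadingSpikeLetters` §2–§3 with
`htop` dropped and `Σ‖log v_z‖²`, `Σ‖log v_z‖` appearing additively; gen 97's versions are the case of vanishing frame masses.
WHAT ([folklore]; 0 def, 0 sorry).  §1 `norm_framePotW_le_mlog_add` (pointwise: `‖f_z‖ ≤ ‖log v_z‖ + ‖log v_z − Σ_m frameLin_m ψ_m‖ + Σ_m PA_m(rem_m)`); §2
**`sum_corners_normSq_framePotW_le`**, **`sum_corners_norm_framePotW_le`**; §3 **`dirSq_curlSq_spikes_le`**, **`sum_norm_curl_spikes_le`** (the spike letters with frame masses).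
HONEST FRAMING (page 1): composition of landed kernel theorems; nothing of Bałaban's asserted; S2′, the frame masses, `hdecomp♭` and NE7 are NOT proved; spine 0∕9; finite T⁴ rung (B)+1 — NOT
infinite volume, NOT mass gap, NOT `BetaPertH`, NOT Clay.  Continuum YM on T⁴ ⇐ BetaPertH ∧ nine spine estimates (0/9 proved); BetaPertH ⇐ (D1) ∧ (D4) ∧ CAP+tail; G-an2-4 gates asym, D1
and NE2/3/4.
-/

set_option autoImplicit false

open scoped BigOperators Matrix Matrix.Norms.L2Operator
open NormedSpace Finset

namespace Summit.QuantumFields.BalabanUV.T4Continuum.NE7FrameReadingSpikeLettersGeneral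

open Literature.MathematicalPhysics.QuantumFieldTheory.Balaban1983to89
open B7Prop1Explicit B7Prop2Explicit B7Prop3Flat MatrixLog
open B7Eq92Concrete (vcov)
open B7Prop4GeneralLevels (logCovIter)
open T4AveragingDeficitWall (Ad IsUnitaryCfg SmallField curl curlAt curlSq dirSq)
open T4AveragingDeficitWallBoundary (IsPeriodicCfg periodBox)
open AveragingDeficitPeriodicCounting (IsPeriodicDir)
open AveragingDeficitTransport (lnorm)
open AveragingDeficitNearIdentity (lnorm_nonneg)
open AveragingDeficitMultiLevelPrep (cavgIter LevelSmall tower)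
open AveragingDeficitMultiLevelBridge (cavgIter_eq_avgIter)
open ReplicationRightInverseBound (radSum)
open BlockAverageVaryHolo (nbRad)
open NE3CovariantLineSumsError (Csup)
open BlockAveragePushDirSplit (frameLin)
open BlockAveragePushDirGauge (gaugeDir)
open NE3TangentCovariantTower (QbarIter framePotW)
open NE3.QbarDictionary (adField)
open NE3.PairLandauB8Avg (relPert)
open NE3CovariantLineSumsL2 (l2sq l2sq_nonneg)
open ShellMeasureAverageProp4General (C1cov C1cov_pos)
open NE3FramePotBoundW (tower_eq_pow_mul)
open NE3CornerSpikes (spikeW r0 spikeW_block)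
open NE3BlockLineAverage (sum_periodBox_blocks)
open NE3CurlOfGaugeDir (norm_curlAt_gaugeDir_le)
open NE3SmoothLiftW (framePotW_add_period)
open MinimalActionLevels (perWin)
open NE7AccumulatedFrameDictionary (frameLin_sub framePotW_eq_sum_frameLin level_dictionary)
open NE7AccumulatedFrameDefectLocal (norm_frameLin_le_pathAvg)
open NE7AccumulatedFrameDefectCornerSums (sum_corners_normSq_defect_le sum_corners_norm_defect_le)
open NE7AccumulatedFrameDefectRemCornerSums (sum_corners_sq_pathAvg_rem_le)
open NE7AccumulatedFrameDefectRemCornerSumsL1 (sum_corners_sum_pathAvg_rem_le)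
open NE7CornerSpikeTopDictionary (dirSq_gaugeDir_spikeW_le curlSq_gaugeDir_spikeW_le)
open NE7TopFrameReadingSpikeLetters (sum_norm_curl_gaugeDir_spikeW_le)


noncomputable section

variable {d : ℕ} {n : Type*} [Fintype n] [DecidableEq n]

/-! ## §1 The residual top frame reading against the frame, pointwise -/

/-- **POINTWISE, NO FRAME CONDITION**: in the Prop-4 regime at level `k` (hypotheses of `NE7AccumulatedFrameDictionary.level_dictionary`),
`‖framePotW L k W X z‖ ≤ ‖log v_k(z)‖ + ‖log v_k(z) − Σ_{m<k} frameLin L W̄^m ψ_m (L^{k−m}z)‖ + Σ_{m<k} PA_m(ψ_m − QbarIter_m X)(L^{k−m}z)` — gen 97's `norm_framePotW_le_of_top` with the frame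
`log v_k(z)` kept as a term instead of set to zero. [folklore] -/
theorem norm_framePotW_le_mlog_add [Nonempty n] {L : ℕ} (hL : 2 ≤ L) (k : ℕ)
    {W : Site d → Fin d → (Matrix n n ℂ)ˣ} (hWu : IsUnitaryCfg W) {X : Site d → Fin d → Matrix n n ℂ}
    {α₀ b : ℝ} (hα : 0 < α₀) (hα3 : C0 d * α₀ ≤ 1 / 3) (hα4 : 4 * α₀ ≤ c2' d L)
    (h52 : pdev W < α₀ * (((L : ℝ) ^ k)⁻¹) ^ 2) (hb : 0 ≤ b) (hX : ∀ (y : Site d) (κ : Fin d), ‖X y κ‖ ≤ b)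
    (hsmall : Real.exp (4 * (800 * ((d : ℝ) + 1) ^ 2 * ((d : ℝ) + 4)) * α₀)
      * (1 + 8 * (131072 * ((d : ℝ) + 1) ^ 2) * ((L : ℝ) ^ k * b)) ≤ 2)
    (hc₃ : 2 * ((L : ℝ) ^ k * b) ≤ c3 d L) (z : Site d) :
    ‖framePotW L k W X z‖
      ≤ ‖mlog ((vcov L W (relPert W X) k z : (Matrix n n ℂ)ˣ) : Matrix n n ℂ)‖
        + ‖mlog ((vcov L W (relPert W X) k z : (Matrix n n ℂ)ˣ) : Matrix n n ℂ)
          - ∑ m ∈ range k, frameLin L (avgIter L W m)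
              (fun x μ => Ad (avgIter L W m x μ)⁻¹ (logCovIter L W (adField W X) m x μ)) (((L : ℤ) ^ (k - m)) • z)‖
        + ∑ m ∈ range k, ((L : ℝ) ^ d)⁻¹ * ∑ r : Fin d → Fin L,
              lnorm (fun x μ => Ad (avgIter L W m x μ)⁻¹ (logCovIter L W (adField W X) m x μ) - QbarIter L m W X x μ)
                (((L : ℤ) ^ (k - m)) • z) (treeWord (boxVec L r)) := by
  letI : CStarAlgebra (Matrix n n ℂ) := {}
  have hdict := level_dictionary hL k hWu (X := X) hα hα3 hα4 h52 hb hX hsmall hc₃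
  set ψ : ℕ → Site d → Fin d → Matrix n n ℂ := fun m x μ => Ad (avgIter L W m x μ)⁻¹ (logCovIter L W (adField W X) m x μ) with hψ
  set y : ℕ → Site d := fun m => ((L : ℤ) ^ (k - m)) • z with hy
  have hrem : ‖∑ m ∈ range k, frameLin L (avgIter L W m) (ψ m) (y m) - framePotW L k W X z‖
      ≤ ∑ m ∈ range k, ((L : ℝ) ^ d)⁻¹ * ∑ r : Fin d → Fin L, lnorm (fun x μ => ψ m x μ - QbarIter L m W X x μ) (y m) (treeWord (boxVec L r)) := by
    rw [framePotW_eq_sum_frameLin L W X k z]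
    have e : ∑ m ∈ range k, frameLin L (cavgIter L m W) (QbarIter L m W X) (((L : ℤ) ^ (k - m)) • z)
        = ∑ m ∈ range k, frameLin L (avgIter L W m) (QbarIter L m W X) (y m) :=
      Finset.sum_congr rfl fun m _ => by rw [cavgIter_eq_avgIter]
    rw [e, ← Finset.sum_sub_distrib]
    refine (norm_sum_le _ _).trans (Finset.sum_le_sum fun m hm => ?_)
    obtain ⟨hUm, -, -, -, -⟩ := hdict m (Finset.mem_range.mp hm).le
    rw [frameLin_sub]
    exact norm_frameLin_le_pathAvg L hUm _ (y m)
  set M₀ : Matrix n n ℂ := mlog ((vcov L W (relPert W X) k z : (Matrix n n ℂ)ˣ) : Matrix n n ℂ) with hM₀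
  set S : Matrix n n ℂ := ∑ m ∈ range k, frameLin L (avgIter L W m) (ψ m) (y m) with hS
  have e1 : framePotW L k W X z = M₀ - (M₀ - S) - (S - framePotW L k W X z) := by abel
  calc ‖framePotW L k W X z‖ = ‖M₀ - (M₀ - S) - (S - framePotW L k W X z)‖ := by rw [← e1]
    _ ≤ ‖M₀ - (M₀ - S)‖ + ‖S - framePotW L k W X z‖ := norm_sub_le _ _
    _ ≤ ‖M₀‖ + ‖M₀ - S‖ + ‖S - framePotW L k W X z‖ := by gcongr; exact norm_sub_le _ _
    _ ≤ _ := add_le_add le_rfl hrem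

/-! ## §2 The corner sums with the frame masses -/

/-- **THE ℓ²-OVER-CORNERS LETTER WITH THE FRAME MASS** (tower class at `W`, Prop-4 regime at the top level `j+1`, `44dL·L^{j+1}b ≤ 1`; NO frame condition):
`Σ_z‖framePotW L (j+1) W X z‖² ≤ 3·Σ_z‖log v_{j+1}(z)‖² + 3·(4096d³L⁵b²L^{j+1}(Σ_m L^mρ₂^m)·l2sq X) + 3·((j+1)·dL·1024K²b²(Σ_{i<j}(L²ρ₂)^i)·l2sq X)`. [folklore] -/
theorem sum_corners_normSq_framePotW_le [Nonempty n] {L N : ℕ} (hL : 2 ≤ L) (hN : 1 ≤ N) (j : ℕ)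
    {W : Site d → Fin d → (Matrix n n ℂ)ˣ} {x : ℝ} (hWu : IsUnitaryCfg W) (hWP : IsPeriodicCfg W ((N * L ^ (j + 1) : ℕ) : ℤ))
    (hx : 0 ≤ x) (hsm : LevelSmall d L j x) (hWx : SmallField W x)
    {α₀ b : ℝ} (hα : 0 < α₀) (hα3 : C0 d * (2 * α₀) ≤ 1 / 3) (hα4 : 4 * (2 * α₀) ≤ c2' d L)
    (h52 : pdev W < α₀ * (((L : ℝ) ^ (j + 1))⁻¹) ^ 2) (hb : 0 ≤ b)
    {X : Site d → Fin d → Matrix n n ℂ} (hX : ∀ (y : Site d) (κ : Fin d), ‖X y κ‖ ≤ b) (hXP : IsPeriodicDir X ((N * L ^ (j + 1) : ℕ) : ℤ))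
    (hsmall : Real.exp (4 * (800 * ((d : ℝ) + 1) ^ 2 * ((d : ℝ) + 4)) * α₀)
      * (1 + 8 * (131072 * ((d : ℝ) + 1) ^ 2) * ((L : ℝ) ^ (j + 1) * b)) ≤ 2)
    (hc₃ : 4 * ((L : ℝ) ^ (j + 1) * b) ≤ c3 d L)
    (hK : 16 * (C1cov d * (L : ℝ) ^ 2 * Real.sqrt (d * (2 * (2 * L) + 1) ^ d)) * (L : ℝ) ^ (j + 1) * b ≤ Real.sqrt ((L : ℝ) ^ 2 / (L : ℝ) ^ d))
    (h44 : 44 * ((d : ℝ) * L * ((L : ℝ) ^ (j + 1) * b)) ≤ 1) :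
    ∑ z ∈ periodBox (d := d) N, ‖framePotW L (j + 1) W X z‖ ^ 2
      ≤ 3 * (∑ z ∈ periodBox (d := d) N, ‖mlog ((vcov L W (relPert W X) (j + 1) z : (Matrix n n ℂ)ˣ) : Matrix n n ℂ)‖ ^ 2)
        + 3 * (4096 * ((d : ℝ) ^ 3 * (L : ℝ) ^ 5) * b ^ 2 * (L : ℝ) ^ (j + 1)
            * (∑ m ∈ range (j + 1), (L : ℝ) ^ m * ((L : ℝ) ^ 2 / (L : ℝ) ^ d) ^ m) * l2sq (periodBox (d := d) (N * L ^ (j + 1))) X)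
        + 3 * (((j : ℝ) + 1) * (((d : ℝ) * L) * (1024 * (C1cov d * (L : ℝ) ^ 2 * Real.sqrt (d * (2 * (2 * L) + 1) ^ d)) ^ 2 * b ^ 2
            * (∑ i ∈ range j, ((L : ℝ) ^ 2 * ((L : ℝ) ^ 2 / (L : ℝ) ^ d)) ^ i) * l2sq (periodBox (d := d) (N * L ^ (j + 1))) X))) := by
  letI : CStarAlgebra (Matrix n n ℂ) := {}
  have hL0 : (0 : ℝ) < L := by exact_mod_cast (show 0 < L by omega)
  have hα3' : C0 d * α₀ ≤ 1 / 3 := by nlinarith [show (0 : ℝ) ≤ C0 d by unfold C0; positivity]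
  have hα4' : 4 * α₀ ≤ c2' d L := by linarith
  have hc₃' : 2 * ((L : ℝ) ^ (j + 1) * b) ≤ c3 d L := by nlinarith [pow_pos hL0 (j + 1)]
  have hA := sum_corners_normSq_defect_le hL hN j hWu hWP hx hsm hWx hα hα3 hα4 h52 hb hX hXP hsmall hc₃ hK h44
  have hB := sum_corners_sq_pathAvg_rem_le hL hN j hWu hWP hx hsm hWx hα hα3 hα4 h52 hb hX hXP hsmall hc₃ hK
  have hpt : ∀ z : Site d, ‖framePotW L (j + 1) W X z‖ ^ 2
      ≤ 3 * ‖mlog ((vcov L W (relPert W X) (j + 1) z : (Matrix n n ℂ)ˣ) : Matrix n n ℂ)‖ ^ 2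
        + 3 * ‖mlog ((vcov L W (relPert W X) (j + 1) z : (Matrix n n ℂ)ˣ) : Matrix n n ℂ)
            - ∑ m ∈ range (j + 1), frameLin L (avgIter L W m)
                (fun x' μ => Ad (avgIter L W m x' μ)⁻¹ (logCovIter L W (adField W X) m x' μ)) (((L : ℤ) ^ (j + 1 - m)) • z)‖ ^ 2
        + 3 * (∑ m ∈ range (j + 1), ((L : ℝ) ^ d)⁻¹ * ∑ r : Fin d → Fin L,
              lnorm (fun x' μ => Ad (avgIter L W m x' μ)⁻¹ (logCovIter L W (adField W X) m x' μ) - QbarIter L m W X x' μ)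
                (((L : ℤ) ^ (j + 1 - m)) • z) (treeWord (boxVec L r))) ^ 2 := by
    intro z
    have h := norm_framePotW_le_mlog_add hL (j + 1) hWu hα hα3' hα4' h52 hb hX hsmall hc₃' z
    have h0 : 0 ≤ ‖framePotW L (j + 1) W X z‖ := norm_nonneg _
    have h3 : ∀ a b c : ℝ, (a + b + c) ^ 2 ≤ 3 * a ^ 2 + 3 * b ^ 2 + 3 * c ^ 2 := fun a b c => by
      nlinarith [sq_nonneg (a - b), sq_nonneg (b - c), sq_nonneg (a - c)]
    exact (pow_le_pow_left₀ h0 h 2).trans (h3 _ _ _)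
  refine (Finset.sum_le_sum fun z _ => hpt z).trans ?_
  rw [Finset.sum_add_distrib, Finset.sum_add_distrib, ← Finset.mul_sum, ← Finset.mul_sum, ← Finset.mul_sum]
  have h3 : (0 : ℝ) ≤ 3 := by norm_num
  exact add_le_add (add_le_add le_rfl (mul_le_mul_of_nonneg_left hA h3)) (mul_le_mul_of_nonneg_left hB h3)

/-- **THE ℓ¹-OVER-CORNERS LETTER WITH THE FRAME MASS** (same regime plus the ℓ¹ tower line `hS1`; NO frame condition):
`Σ_z‖framePotW L (j+1) W X z‖ ≤ Σ_z‖log v_{j+1}(z)‖ + 16dL(6Σ_mL^mρ₂^m + 2Σ_mρ₂^m)·l2sq X + 64C₁L²d(4L+1)^d(Σ_{i<j}((L∕L^d)L)^i)·l2sq X`. [folklore] -/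
theorem sum_corners_norm_framePotW_le [Nonempty n] {L N : ℕ} (hL : 2 ≤ L) (hN : 1 ≤ N) (j : ℕ)
    {W : Site d → Fin d → (Matrix n n ℂ)ˣ} {x : ℝ} (hWu : IsUnitaryCfg W) (hWP : IsPeriodicCfg W ((N * L ^ (j + 1) : ℕ) : ℤ))
    (hx : 0 ≤ x) (hsm : LevelSmall d L j x) (hWx : SmallField W x)
    {α₀ b : ℝ} (hα : 0 < α₀) (hα3 : C0 d * (2 * α₀) ≤ 1 / 3) (hα4 : 4 * (2 * α₀) ≤ c2' d L)
    (h52 : pdev W < α₀ * (((L : ℝ) ^ (j + 1))⁻¹) ^ 2) (hb : 0 ≤ b)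
    {X : Site d → Fin d → Matrix n n ℂ} (hX : ∀ (y : Site d) (κ : Fin d), ‖X y κ‖ ≤ b) (hXP : IsPeriodicDir X ((N * L ^ (j + 1) : ℕ) : ℤ))
    (hsmall : Real.exp (4 * (800 * ((d : ℝ) + 1) ^ 2 * ((d : ℝ) + 4)) * α₀)
      * (1 + 8 * (131072 * ((d : ℝ) + 1) ^ 2) * ((L : ℝ) ^ (j + 1) * b)) ≤ 2)
    (hc₃ : 4 * ((L : ℝ) ^ (j + 1) * b) ≤ c3 d L)
    (hK : 16 * (C1cov d * (L : ℝ) ^ 2 * Real.sqrt (d * (2 * (2 * L) + 1) ^ d)) * (L : ℝ) ^ (j + 1) * b ≤ Real.sqrt ((L : ℝ) ^ 2 / (L : ℝ) ^ d))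
    (hS1 : (16 * (d + 1) * (d + 4) * (L : ℝ) ^ 2 * Csup d L * (d * (2 * nbRad d L + 1) ^ d)) * radSum d L j x ≤ ((L : ℝ) / (L : ℝ) ^ d) / 2)
    (h44 : 44 * ((d : ℝ) * L * ((L : ℝ) ^ (j + 1) * b)) ≤ 1) :
    ∑ z ∈ periodBox (d := d) N, ‖framePotW L (j + 1) W X z‖
      ≤ (∑ z ∈ periodBox (d := d) N, ‖mlog ((vcov L W (relPert W X) (j + 1) z : (Matrix n n ℂ)ˣ) : Matrix n n ℂ)‖)
        + 16 * ((d : ℝ) * L) * (6 * (∑ m ∈ range (j + 1), (L : ℝ) ^ m * ((L : ℝ) ^ 2 / (L : ℝ) ^ d) ^ m)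
            + 2 * ∑ m ∈ range (j + 1), ((L : ℝ) ^ 2 / (L : ℝ) ^ d) ^ m) * l2sq (periodBox (d := d) (N * L ^ (j + 1))) X
        + 64 * (C1cov d * (L : ℝ) ^ 2 * (d * (2 * (2 * (L : ℝ)) + 1) ^ d)) * (∑ i ∈ range j, (((L : ℝ) / (L : ℝ) ^ d) * L) ^ i)
            * l2sq (periodBox (d := d) (N * L ^ (j + 1))) X := by
  letI : CStarAlgebra (Matrix n n ℂ) := {}
  have hL0 : (0 : ℝ) < L := by exact_mod_cast (show 0 < L by omega)
  have hα3' : C0 d * α₀ ≤ 1 / 3 := by nlinarith [show (0 : ℝ) ≤ C0 d by unfold C0; positivity]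
  have hα4' : 4 * α₀ ≤ c2' d L := by linarith
  have hc₃' : 2 * ((L : ℝ) ^ (j + 1) * b) ≤ c3 d L := by nlinarith [pow_pos hL0 (j + 1)]
  have hA := sum_corners_norm_defect_le hL hN j hWu hWP hx hsm hWx hα hα3 hα4 h52 hb hX hXP hsmall hc₃ hK h44
  have hB := sum_corners_sum_pathAvg_rem_le hL hN j hWu hWP hx hsm hWx hα hα3 hα4 h52 hb hX hXP hsmall hc₃ hK hS1
  have hpt := fun z : Site d => norm_framePotW_le_mlog_add hL (j + 1) hWu hα hα3' hα4' h52 hb hX hsmall hc₃' z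
  refine (Finset.sum_le_sum fun z _ => hpt z).trans ?_
  rw [Finset.sum_add_distrib, Finset.sum_add_distrib]
  exact add_le_add (add_le_add le_rfl hA) hB

/-! ## §3 The spike letters with the frame masses -/

/-- **THE ℓ² LETTERS OF THE SPIKES WITH THE FRAME MASS**: with `M = L^{j+1}`, `S := gaugeDir W (spikeW M (framePotW L (j+1) W X))` and `B₂ :=` the bound of `sum_corners_normSq_framePotW_le`,
`dirSq S [0,M·N)^d ≤ 4d·B₂` and `curlSq_W S [0,M·N)^d ≤ 4x²·#Plane·B₂`. [folklore] -/
theorem dirSq_curlSq_spikes_le [Nonempty n] {L N : ℕ} [NeZero N] (hL : 2 ≤ L) (hN : 1 ≤ N) (j : ℕ)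
    {W : Site d → Fin d → (Matrix n n ℂ)ˣ} {x : ℝ} (hWu : IsUnitaryCfg W) (hWP : IsPeriodicCfg W ((N * L ^ (j + 1) : ℕ) : ℤ))
    (hx : 0 ≤ x) (hsm : LevelSmall d L j x) (hWx : SmallField W x)
    {α₀ b : ℝ} (hα : 0 < α₀) (hα3 : C0 d * (2 * α₀) ≤ 1 / 3) (hα4 : 4 * (2 * α₀) ≤ c2' d L)
    (h52 : pdev W < α₀ * (((L : ℝ) ^ (j + 1))⁻¹) ^ 2) (hb : 0 ≤ b)
    {X : Site d → Fin d → Matrix n n ℂ} (hX : ∀ (y : Site d) (κ : Fin d), ‖X y κ‖ ≤ b) (hXP : IsPeriodicDir X ((N * L ^ (j + 1) : ℕ) : ℤ))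
    (hsmall : Real.exp (4 * (800 * ((d : ℝ) + 1) ^ 2 * ((d : ℝ) + 4)) * α₀)
      * (1 + 8 * (131072 * ((d : ℝ) + 1) ^ 2) * ((L : ℝ) ^ (j + 1) * b)) ≤ 2)
    (hc₃ : 4 * ((L : ℝ) ^ (j + 1) * b) ≤ c3 d L)
    (hK : 16 * (C1cov d * (L : ℝ) ^ 2 * Real.sqrt (d * (2 * (2 * L) + 1) ^ d)) * (L : ℝ) ^ (j + 1) * b ≤ Real.sqrt ((L : ℝ) ^ 2 / (L : ℝ) ^ d))
    (h44 : 44 * ((d : ℝ) * L * ((L : ℝ) ^ (j + 1) * b)) ≤ 1) :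
    dirSq (gaugeDir W (spikeW (L ^ (j + 1)) (framePotW L (j + 1) W X))) (periodBox (d := d) (L ^ (j + 1) * N))
        ≤ 4 * (d : ℝ) * (3 * (∑ z ∈ periodBox (d := d) N, ‖mlog ((vcov L W (relPert W X) (j + 1) z : (Matrix n n ℂ)ˣ) : Matrix n n ℂ)‖ ^ 2)
        + 3 * (4096 * ((d : ℝ) ^ 3 * (L : ℝ) ^ 5) * b ^ 2 * (L : ℝ) ^ (j + 1)
            * (∑ m ∈ range (j + 1), (L : ℝ) ^ m * ((L : ℝ) ^ 2 / (L : ℝ) ^ d) ^ m) * l2sq (periodBox (d := d) (N * L ^ (j + 1))) X)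
        + 3 * (((j : ℝ) + 1) * (((d : ℝ) * L) * (1024 * (C1cov d * (L : ℝ) ^ 2 * Real.sqrt (d * (2 * (2 * L) + 1) ^ d)) ^ 2 * b ^ 2
            * (∑ i ∈ range j, ((L : ℝ) ^ 2 * ((L : ℝ) ^ 2 / (L : ℝ) ^ d)) ^ i) * l2sq (periodBox (d := d) (N * L ^ (j + 1))) X))))
      ∧ curlSq W (gaugeDir W (spikeW (L ^ (j + 1)) (framePotW L (j + 1) W X))) (periodBox (d := d) (L ^ (j + 1) * N))
        ≤ 4 * x ^ 2 * (Fintype.card (T4AveragingDeficitWall.Plane d)) * (3 * (∑ z ∈ periodBox (d := d) N, ‖mlog ((vcov L W (relPert W X) (j + 1) z : (Matrix n n ℂ)ˣ) : Matrix n n ℂ)‖ ^ 2)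
        + 3 * (4096 * ((d : ℝ) ^ 3 * (L : ℝ) ^ 5) * b ^ 2 * (L : ℝ) ^ (j + 1)
            * (∑ m ∈ range (j + 1), (L : ℝ) ^ m * ((L : ℝ) ^ 2 / (L : ℝ) ^ d) ^ m) * l2sq (periodBox (d := d) (N * L ^ (j + 1))) X)
        + 3 * (((j : ℝ) + 1) * (((d : ℝ) * L) * (1024 * (C1cov d * (L : ℝ) ^ 2 * Real.sqrt (d * (2 * (2 * L) + 1) ^ d)) ^ 2 * b ^ 2
            * (∑ i ∈ range j, ((L : ℝ) ^ 2 * ((L : ℝ) ^ 2 / (L : ℝ) ^ d)) ^ i) * l2sq (periodBox (d := d) (N * L ^ (j + 1))) X)))) := by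
  have hM : 1 ≤ L ^ (j + 1) := Nat.one_le_pow _ L (by omega)
  have hT : ((tower L N (j + 1) : ℕ) : ℤ) = ((N * L ^ (j + 1) : ℕ) : ℤ) := by rw [tower_eq_pow_mul, Nat.mul_comm]
  have hWPt : IsPeriodicCfg W ((tower L N (j + 1) : ℕ) : ℤ) := by rw [hT]; exact hWP
  have hXPt : IsPeriodicDir X ((tower L N (j + 1) : ℕ) : ℤ) := by rw [hT]; exact hXP
  have hfP : ∀ (z : Site d) (τ : Fin d), framePotW L (j + 1) W X (z + (N : ℤ) • e τ) = framePotW L (j + 1) W X z :=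
    framePotW_add_period L j hWPt hXPt
  have h2 := sum_corners_normSq_framePotW_le hL hN j hWu hWP hx hsm hWx hα hα3 hα4 h52 hb hX hXP hsmall hc₃ hK h44
  refine ⟨?_, ?_⟩
  · exact (dirSq_gaugeDir_spikeW_le hM hN hWu hfP).trans (mul_le_mul_of_nonneg_left h2 (by positivity))
  · exact (curlSq_gaugeDir_spikeW_le hM N hWu hWx (framePotW L (j + 1) W X)).trans (mul_le_mul_of_nonneg_left h2 (by positivity))

/-- **THE ℓ¹ CURL LETTER OF THE SPIKES WITH THE FRAME MASS**: `Σ_{p∈perWin(M·N)}‖curl_W S p‖ ≤ 2x·#Plane·B₁`, `B₁ :=` the bound of `sum_corners_norm_framePotW_le`. [folklore] -/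
theorem sum_norm_curl_spikes_le [Nonempty n] {L N : ℕ} (hL : 2 ≤ L) (hN : 1 ≤ N) (j : ℕ)
    {W : Site d → Fin d → (Matrix n n ℂ)ˣ} {x : ℝ} (hWu : IsUnitaryCfg W) (hWP : IsPeriodicCfg W ((N * L ^ (j + 1) : ℕ) : ℤ))
    (hx : 0 ≤ x) (hsm : LevelSmall d L j x) (hWx : SmallField W x)
    {α₀ b : ℝ} (hα : 0 < α₀) (hα3 : C0 d * (2 * α₀) ≤ 1 / 3) (hα4 : 4 * (2 * α₀) ≤ c2' d L)
    (h52 : pdev W < α₀ * (((L : ℝ) ^ (j + 1))⁻¹) ^ 2) (hb : 0 ≤ b)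
    {X : Site d → Fin d → Matrix n n ℂ} (hX : ∀ (y : Site d) (κ : Fin d), ‖X y κ‖ ≤ b) (hXP : IsPeriodicDir X ((N * L ^ (j + 1) : ℕ) : ℤ))
    (hsmall : Real.exp (4 * (800 * ((d : ℝ) + 1) ^ 2 * ((d : ℝ) + 4)) * α₀)
      * (1 + 8 * (131072 * ((d : ℝ) + 1) ^ 2) * ((L : ℝ) ^ (j + 1) * b)) ≤ 2)
    (hc₃ : 4 * ((L : ℝ) ^ (j + 1) * b) ≤ c3 d L)
    (hK : 16 * (C1cov d * (L : ℝ) ^ 2 * Real.sqrt (d * (2 * (2 * L) + 1) ^ d)) * (L : ℝ) ^ (j + 1) * b ≤ Real.sqrt ((L : ℝ) ^ 2 / (L : ℝ) ^ d))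
    (hS1 : (16 * (d + 1) * (d + 4) * (L : ℝ) ^ 2 * Csup d L * (d * (2 * nbRad d L + 1) ^ d)) * radSum d L j x ≤ ((L : ℝ) / (L : ℝ) ^ d) / 2)
    (h44 : 44 * ((d : ℝ) * L * ((L : ℝ) ^ (j + 1) * b)) ≤ 1) :
    ∑ p ∈ perWin d (L ^ (j + 1) * N), ‖curl W (gaugeDir W (spikeW (L ^ (j + 1)) (framePotW L (j + 1) W X))) p‖
      ≤ 2 * x * (Fintype.card (T4AveragingDeficitWall.Plane d)) * ((∑ z ∈ periodBox (d := d) N, ‖mlog ((vcov L W (relPert W X) (j + 1) z : (Matrix n n ℂ)ˣ) : Matrix n n ℂ)‖)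
        + 16 * ((d : ℝ) * L) * (6 * (∑ m ∈ range (j + 1), (L : ℝ) ^ m * ((L : ℝ) ^ 2 / (L : ℝ) ^ d) ^ m)
            + 2 * ∑ m ∈ range (j + 1), ((L : ℝ) ^ 2 / (L : ℝ) ^ d) ^ m) * l2sq (periodBox (d := d) (N * L ^ (j + 1))) X
        + 64 * (C1cov d * (L : ℝ) ^ 2 * (d * (2 * (2 * (L : ℝ)) + 1) ^ d)) * (∑ i ∈ range j, (((L : ℝ) / (L : ℝ) ^ d) * L) ^ i)
            * l2sq (periodBox (d := d) (N * L ^ (j + 1))) X) := by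
  have hM : 1 ≤ L ^ (j + 1) := Nat.one_le_pow _ L (by omega)
  have h1 := sum_corners_norm_framePotW_le hL hN j hWu hWP hx hsm hWx hα hα3 hα4 h52 hb hX hXP hsmall hc₃ hK hS1 h44
  exact (sum_norm_curl_gaugeDir_spikeW_le hM N hWu hWx (framePotW L (j + 1) W X)).trans (mul_le_mul_of_nonneg_left h1 (by positivity))

end

end Summit.QuantumFields.BalabanUV.T4Continuum.NE7FrameReadingSpikeLettersGeneral
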